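import Summits.RiemannHypothesis.RiemannHypothesis.Theses.SpectralTrace
import Summits.RiemannHypothesis.RiemannHypothesis.Theorems.WindowTraceArch.Negative.ComplexSpectrum
import Literature.NumberTheory.LFunctions.WeilWindowSimpleEven
import Literature.NumberTheory.LFunctions.WeilMellinInversion
import Literature.NumberTheory.LFunctions.WeilArchimedeanPositivityProofs
import Literature.NumberTheory.LFunctions.WeilGroundEnergyProofs
import Literature.NumberTheory.LFunctions.WeilCriterionProofs
import Literature.NumberTheory.LFunctions.ZetaRealAxis
import HarnessLib

/-!
# `SpectralThesis` (stmt-RiemannHypothesis-0187): parity — odd tests, even tests, one-sided spectra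

Negative-lane lemmas for the route target `X = SpectralThesis` of route SpectralTrace
(refuter / cdisprove seat; supports stmt-RiemannHypothesis-0187).

* `weilFunctional_eq_zero_of_odd` : `W` vanishes on odd functions (hypothesis-free), hence
  `hasSum_zero_of_odd_of_trace` : every real family reproducing `W` on all Weil tests satisfies
  `Σ_i ĝ(1/2+iγ_i) = 0` on every ODD Weil test — the constraint a one-sided ("positive energy")
  spectrum cannot meet (`TwoSided.lean`: `not_spectralThesis_nonneg`).
* `riemannHypothesis_of_even_trace` : a real family reproducing `W` on the EVEN Weil tests alone
  already proves RH (parity splitting `Q(g) = Q(g₊) + Q(g₋)` and evenness of the kernels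
  `g± ⋆ (g±)̃`).
* `spectralThesisEven_iff_riemannHypothesis`, `spectralThesisEvenPos_iff_riemannHypothesis` : the
  even-test variant of `X`, and the REPAIRED one-sided statement "a POSITIVE spectrum reproduces
  `W` on even tests", are each equivalent to RH (under RH: `|Im ρ|` with multiplicity). So the
  one-sided refutation in `TwoSided.lean` bites the normalisation of `X` (all tests), not the
  one-sided mechanism.
-/

noncomputable section

open Complex Set MeasureTheory Filter

namespace Summit.RiemannHypothesis.RiemannHypothesis.Theorems.SpectralThesis.Negative

open Literature.NumberTheory.LFunctions
open Summit.RiemannHypothesis.RiemannHypothesis.Theorems.WindowTraceArch.Negative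

variable {ι : Type*} {γ : ι → ℝ}

/-- `W` vanishes on ODD functions (hypothesis-free: `W(g(-·)) = W(g)`, `weilFunctional_comp_neg`,
and `W(c·g) = c·W(g)`, `weilFunctional_const_mul`). [folklore] -/
theorem weilFunctional_eq_zero_of_odd {g : ℝ → ℂ} (ho : ∀ t, g (-t) = -g t) :
    weilFunctional g = 0 := by
  have h1 : (fun t => g (-t)) = fun t => (-1 : ℂ) * g t := funext fun t => by rw [ho, neg_one_mul]
  have h := weilFunctional_comp_neg g
  rw [h1, weilFunctional_const_mul] at h
  linear_combination (-1 / 2 : ℂ) * h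

/-- For a real family reproducing `W` on all Weil tests, `Σ_i ĝ(1/2 + iγ_i) = 0` on every ODD
Weil test. [folklore] -/
theorem hasSum_zero_of_odd_of_trace
    (h : ∀ g : ℝ → ℂ, IsWeilTest g →
      HasSum (fun i => weilMellin g (1 / 2 + (γ i : ℂ) * I)) (weilFunctional g))
    {g : ℝ → ℂ} (hg : IsWeilTest g) (ho : ∀ t, g (-t) = -g t) :
    HasSum (fun i => weilMellin g (1 / 2 + (γ i : ℂ) * I)) 0 := by
  simpa only [weilFunctional_eq_zero_of_odd ho] using h g hg

/-- For an EVEN function, `ĝ(1/2 - iu) = ĝ(1/2 + iu)` (`weilMellin_comp_neg`). [folklore] -/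
theorem weilMellin_half_neg_of_even {g : ℝ → ℂ} (he : ∀ t, g (-t) = g t) (u : ℝ) :
    weilMellin g (1 / 2 + ((-u : ℝ) : ℂ) * I) = weilMellin g (1 / 2 + (u : ℂ) * I) := by
  have h1 : (fun t => g (-t)) = g := funext he
  have h := weilMellin_comp_neg g (1 / 2 + (u : ℂ) * I)
  rw [h1] at h
  rw [h]
  congr 1
  push_cast
  ring

/-- `f ⋆ f̃` is even when `f` is even. [folklore] -/
theorem even_weilConv_weilReflect_of_even {f : ℝ → ℂ} (he : ∀ t, f (-t) = f t) (t : ℝ) :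
    weilConv f (weilReflect f) (-t) = weilConv f (weilReflect f) t := by
  have h1 : (fun t => f (-t)) = f := funext he
  have h2 : (fun t => weilConv f (weilReflect f) (-t)) = weilConv f (weilReflect f) := by
    rw [← weilConv_comp_neg, ← weilReflect_comp_neg, h1]
  exact congrFun h2 t

/-- `f ⋆ f̃` is even when `f` is odd. [folklore] -/
theorem even_weilConv_weilReflect_of_odd {f : ℝ → ℂ} (ho : ∀ t, f (-t) = -f t) (t : ℝ) :
    weilConv f (weilReflect f) (-t) = weilConv f (weilReflect f) t := by
  have h1 : (fun t => f (-t)) = fun t => (-1 : ℂ) * f t := funext fun t => by rw [ho, neg_one_mul]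
  have h2 : (fun t => weilConv f (weilReflect f) (-t)) = weilConv f (weilReflect f) := by
    rw [← weilConv_comp_neg, ← weilReflect_comp_neg, h1, weilReflect_const_mul, map_neg, map_one,
      weilConv_const_mul_right, weilConv_const_mul_left]
    funext t
    beta_reduce
    ring
  exact congrFun h2 t

/-- **Reproducing `W` on the EVEN Weil tests already proves RH**: `Q(g) = Q(g₊) + Q(g₋)`
(`weilQuadratic_eq_evenPart_add_oddPart`), the kernels `g± ⋆ (g±)̃` are even, and on an even
kernel the hypothesis gives the Bochner form `Re Q(g±) = Σ_i |ĝ±(1/2+iγ_i)|² ≥ 0`; then Weil's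
criterion (`weil_criterion_holds`). [folklore] -/
theorem riemannHypothesis_of_even_trace
    (h : ∀ g : ℝ → ℂ, IsWeilTest g → (∀ t, g (-t) = g t) →
      HasSum (fun i => weilMellin g (1 / 2 + (γ i : ℂ) * I)) (weilFunctional g)) :
    _root_.RiemannHypothesis := by
  refine (show _root_.RiemannHypothesis ↔ WeilPositivity from weil_criterion_holds).2 fun g hg => ?_
  have key : ∀ f : ℝ → ℂ, IsWeilTest f →
      (∀ t, weilConv f (weilReflect f) (-t) = weilConv f (weilReflect f) t) →
        0 ≤ (weilQuadratic f).re := by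
    intro f hf hev
    have hk : IsWeilTest (weilConv f (weilReflect f)) := hf.weilConv hf.weilReflect
    have hs := h _ hk hev
    have hs' : HasSum (fun i => ((‖weilMellin f (1 / 2 + (γ i : ℂ) * I)‖ ^ 2 : ℝ) : ℂ))
        (weilQuadratic f) := by
      unfold weilQuadratic
      simpa only [weilMellin_weilConv_weilReflect_half hf] using hs
    have hre := hs'.mapL Complex.reCLM
    simp only [Complex.reCLM_apply, Complex.ofReal_re] at hre
    exact hre.nonneg fun i => by positivity
  rw [weilQuadratic_eq_evenPart_add_oddPart hg, Complex.add_re]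
  refine add_nonneg (key _ hg.evenPart (even_weilConv_weilReflect_of_even fun t => ?_))
    (key _ hg.oddPart (even_weilConv_weilReflect_of_odd fun t => ?_))
  · simp only [neg_neg]
    ring
  · simp only [neg_neg]
    ring

/-- Non-trivial zeros of `ζ` are non-real (no zeros on the real segment `(0, 1)`,
`riemannZeta_ne_zero_of_im_eq_zero_of_pos_of_lt_one`). [folklore] -/
theorem im_ne_zero_of_mem_nontrivialZeros (ρ : ZetaZeros.riemannZetaNontrivialZeros) :
    (ρ : ℂ).im ≠ 0 := fun him =>
  riemannZeta_ne_zero_of_im_eq_zero_of_pos_of_lt_one him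
    (ZetaZeros.riemannZetaNontrivialZeros.re_pos ρ.2)
    (ZetaZeros.riemannZetaNontrivialZeros.re_lt_one ρ.2)
    (ZetaZeros.riemannZetaNontrivialZeros.zeta_eq_zero ρ.2)

/-- **`RH →` a POSITIVE spectrum reproduces `W` on even tests**: the absolute ordinates `|Im ρ|`
with multiplicity (every level doubled, `ρ` and `ρ̄`; `hasSum_weilMellin_zeros`,
`eq_half_add_of_riemannHypothesis`, evenness `weilMellin_half_neg_of_even`). [folklore] -/
theorem exists_pos_even_trace_of_riemannHypothesis (hRH : _root_.RiemannHypothesis) :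
    ∃ (ι : Type) (γ : ι → ℝ), (∀ i, 0 < γ i) ∧ ∀ g : ℝ → ℂ, IsWeilTest g → (∀ t, g (-t) = g t) →
      HasSum (fun i => weilMellin g (1 / 2 + (γ i : ℂ) * I)) (weilFunctional g) := by
  refine ⟨(Σ ρ : ZetaZeros.riemannZetaNontrivialZeros, Fin (riemannZetaZeroOrder (ρ : ℂ)).toNat),
    fun p => |(p.1 : ℂ).im|, fun p => abs_pos.2 (im_ne_zero_of_mem_nontrivialZeros p.1),
    fun g hg hev => ?_⟩
  have h := hasSum_weilMellin_zeros hg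
  convert h using 2
  rename_i p
  dsimp only
  conv_rhs => rw [← eq_half_add_of_riemannHypothesis hRH p.1]
  rcases le_or_gt 0 ((p.1 : ℂ).im) with hp | hp
  · rw [abs_of_nonneg hp]
  · rw [abs_of_neg hp, weilMellin_half_neg_of_even hev]

/-- **The even-test variant of `SpectralThesis` is equivalent to RH.** [folklore] -/
theorem spectralThesisEven_iff_riemannHypothesis :
    (∃ (ι : Type) (γ : ι → ℝ), ∀ g : ℝ → ℂ, IsWeilTest g → (∀ t, g (-t) = g t) →
      HasSum (fun i => weilMellin g (1 / 2 + (γ i : ℂ) * I)) (weilFunctional g)) ↔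
      _root_.RiemannHypothesis :=
  ⟨fun ⟨_, _, h⟩ => riemannHypothesis_of_even_trace h, fun hRH => by
    obtain ⟨ι, γ, -, h⟩ := exists_pos_even_trace_of_riemannHypothesis hRH
    exact ⟨ι, γ, h⟩⟩

/-- **The repaired one-sided statement is equivalent to RH**: "some POSITIVE real spectrum
reproduces `W` on every even Weil test" `↔ RH`. Hence the refutation `not_spectralThesis_nonneg`
of the literal one-sided strengthening of `X` (all tests) exploits only the parity normalisation
(odd tests force `Σ_i ĝ(1/2+iγ_i) = 0`), not the one-sided mechanism. [folklore] -/
theorem spectralThesisEvenPos_iff_riemannHypothesis :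
    (∃ (ι : Type) (γ : ι → ℝ), (∀ i, 0 < γ i) ∧ ∀ g : ℝ → ℂ, IsWeilTest g → (∀ t, g (-t) = g t) →
      HasSum (fun i => weilMellin g (1 / 2 + (γ i : ℂ) * I)) (weilFunctional g)) ↔
      _root_.RiemannHypothesis :=
  ⟨fun ⟨_, _, _, h⟩ => riemannHypothesis_of_even_trace h,
    exists_pos_even_trace_of_riemannHypothesis⟩

end Summit.RiemannHypothesis.RiemannHypothesis.Theorems.SpectralThesis.Negative

end
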